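import Summits.ResolutionOfSingularities.ResolutionOfSingularities.Theorems.FrobeniusClosingPatchingRelPerfectDepthSncLocusOpenRing
import Summits.ResolutionOfSingularities.ResolutionOfSingularities.Theorems.FrobeniusClosingPatchingRelPerfectDepthSNCPointwise
import Literature.AlgebraicGeometry.Resolution.StrictNormalCrossingsSpread
import Literature.AlgebraicGeometry.Resolution.FormalNormalCrossingsAlgebra
import Literature.AlgebraicGeometry.Resolution.QuasiExcellentSchemes
import HarnessLib

/-!
# Crux `PatchingRelPerfect` (stmt-ResolutionOfSingularities-16161), chain W5.2 — F7(β) (β-AX) A1 bridge (c):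
# THE SNC-WITH LOCUS IS OPEN — `SNCWithAt 𝓕 ⊤` spreads from a point (hence from a closed set) to an open neighbourhood
# on a Noetherian quasi-excellent scheme

[OURS · L1 W5.2 · rung tool; res-L1-w52-plan-1 RULING G11-17 (4) / NAMING 2026-08-27T16:26:25Z → res-D-pv-046]
Replaces the role of NO printed item of the manuscript under review; fact-free; any dimension, any characteristic.
PRESEARCH: «snc locus open» — no typed lemma in the tree for the LABELLED pointwise predicate `SNCWithAt` (rg «isOpen»
× «SNC» = 0 hits outside the divisor predicate); the divisor form `IsStrictNormalCrossingsAt.exists_mem_forall`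
(`Literature/…/StrictNormalCrossingsSpread.lean`, finite type over a perfect field) and its ring core
`IsSNCIdeal.exists_notMem_forall` are the nearest prior art and this file follows them; folklore in print
(the condition «part of a regular system of parameters» is open on a J-2 scheme: Matsumura Thm. 14.2 + §32).

* `exists_mem_forall_sncWithAt` — at a point `x` with `SNCWithAt 𝓕 ⊤ x` there is an open `U ∋ x` with `SNCWithAt 𝓕 ⊤ y`
  for every `y ∈ U` (`X` Noetherian and quasi-excellent). Proof (G11-17 (4)): on an affine open `W ∋ x` with `R = Γ(X, W)`
  and `𝔭` the prime of `x`, the adapted regular system of parameters at `x` gives, for the members `D₁, …, D_r` of `𝓕`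
  through `x`, elements `aᵢ ∈ R` with `Dᵢ|_W · R_𝔭 = (aᵢ)` and independent differentials at `𝔭` (pulled back to
  `R_𝔭` along `R_𝔭 ≅ 𝒪_{X,x}`, denominators cleared); the ring theorem
  `DepthSNC.exists_notMem_forall_independent` (J-2 from `Scheme.IsQuasiExcellent`) and the spreading of the `r`
  ideal equalities and of «the members NOT through `x` stay away» give a basic open `D(f) ∋ x` on which, at every `y`,
  the `aᵢ` with `y ∈ V(Dᵢ)` have independent differentials in `R_𝔮`, hence (`exists_extend_to_rsop`, transported to
  `𝒪_{X,y}`) extend to a regular system of parameters adapted to `𝓕` — i.e. `SNCWithAt 𝓕 ⊤ y`.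
* **`exists_isOpen_forall_sncWithAt`** — the form NAMED by the planner: `Z` closed (closedness is not used: the union
  of the pointwise neighbourhoods serves) with `SNCWithAt 𝓕 ⊤` on `Z` ⇒ an open `U ⊇ Z` with `SNCWithAt 𝓕 ⊤` on `U`.

## References (for the mathematics; nothing here is a statement of the manuscript under review)
* H. Matsumura, *Commutative Ring Theory* (1986), Thm. 14.2; §32 p. 260 (J-2). [Matsumura1987]
* E. Bierstone, D. Grigoriev, P. Milman, J. Włodarczyk, arXiv:1206.3090, Def. 3.1.1. [BierstoneGrigorievMilmanWlodarczyk2011]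
* The Stacks Project, Tags 07P7, 0BIA. [StacksProject]
-/

-- `Summit.<Summit>.<Sub>.Theorems` with `Sub = Summit` (single-conjunct summit, D-0017)
set_option linter.dupNamespace false

noncomputable section

open CategoryTheory AlgebraicGeometry TopologicalSpace IsLocalRing
open Literature.AlgebraicGeometry.Resolution

namespace Summit.ResolutionOfSingularities.ResolutionOfSingularities.Theorems

universe u

namespace DepthSNC

/-! ## §1 Ring-isomorphism bookkeeping -/

section RingEquiv

variable {A B : Type u} [CommRing A] [CommRing B] [IsLocalRing A] [IsLocalRing B] (e : A ≃+* B)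

/-- A ring isomorphism of local rings detects non-units: `a ∈ 𝔪_A ↔ e a ∈ 𝔪_B`. [folklore] -/
theorem mem_maximalIdeal_iff_of_ringEquiv (a : A) : a ∈ maximalIdeal A ↔ e a ∈ maximalIdeal B := by
  rw [mem_maximalIdeal, mem_maximalIdeal, mem_nonunits_iff, mem_nonunits_iff, not_iff_not]
  exact ⟨fun h => h.map e, fun h => by simpa using h.map e.symm⟩

/-- A ring isomorphism of local rings maps the maximal ideal onto the maximal ideal. [folklore] -/
theorem map_maximalIdeal_of_ringEquiv : (maximalIdeal A).map (e : A →+* B) = maximalIdeal B := by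
  ext b
  rw [Ideal.map_comap_of_equiv, Ideal.mem_comap]
  rw [mem_maximalIdeal_iff_of_ringEquiv e (e.symm b), RingEquiv.apply_symm_apply]

/-- **The relation form of «independent differentials» transports along a ring isomorphism of local rings.**
[folklore] -/
theorem forall_mem_maximalIdeal_of_ringEquiv {t : ℕ} (w : Fin t → A)
    (h : ∀ c : Fin t → A, ∑ j, c j * w j ∈ (maximalIdeal A) ^ 2 → ∀ j, c j ∈ maximalIdeal A) :
    ∀ c : Fin t → B, ∑ j, c j * e (w j) ∈ (maximalIdeal B) ^ 2 → ∀ j, c j ∈ maximalIdeal B := by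
  intro c hc j
  have hsum : e.symm (∑ j, c j * e (w j)) = ∑ j, e.symm (c j) * w j := by
    rw [map_sum]
    exact Finset.sum_congr rfl fun j _ => by rw [map_mul, RingEquiv.symm_apply_apply]
  have hmem : ∑ j, e.symm (c j) * w j ∈ (maximalIdeal A) ^ 2 := by
    rw [← hsum, ← map_maximalIdeal_of_ringEquiv e, ← Ideal.map_pow, Ideal.map_comap_of_equiv,
      Ideal.mem_comap] at *
    simpa using hc
  have := h _ hmem j
  rwa [mem_maximalIdeal_iff_of_ringEquiv e, RingEquiv.apply_symm_apply] at this

end RingEquiv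

/-! ## §2 Affine-chart bookkeeping for ideal sheaves -/

section Chart

variable {X : Scheme.{u}} {W : X.Opens} (hW : IsAffineOpen W)

/-- On an affine open `W ∋ y`, a point lies in the support of an ideal sheaf iff the ideal of sections over `W` is
contained in the prime of the point. [folklore] -/
theorem mem_support_iff_ideal_le (I : X.IdealSheafData) {y : X} (hyW : y ∈ W) :
    y ∈ I.support ↔ I.ideal ⟨W, hW⟩ ≤ (hW.primeIdealOf ⟨y, hyW⟩).asIdeal := by
  rw [Scheme.IdealSheafData.mem_support_iff_of_mem (U := ⟨W, hW⟩) hyW, Scheme.mem_zeroLocus_iff]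
  refine forall₂_congr fun f _ => ?_
  rw [mem_basicOpen_iff_notMem_primeIdealOf hW hyW f, not_not]

/-- On an affine open `W ∋ y`, with `𝒪_{X,y}` as localisation of `R = Γ(X, W)` at the prime `𝔮` of `y` and
`e : R_𝔮 ≃ 𝒪_{X,y}` the canonical isomorphism: the stalk of an ideal sheaf is the image of the extended ideal
`I(W) R_𝔮`. [folklore] -/
theorem stalkIdeal_eq_map_map_algEquiv (I : X.IdealSheafData) {y : X} (hyW : y ∈ W) :
    letI := TopCat.Presheaf.algebra_section_stalk X.presheaf (⟨y, hyW⟩ : W)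
    haveI := hW.isLocalization_stalk ⟨y, hyW⟩
    stalkIdeal I y = ((I.ideal ⟨W, hW⟩).map (algebraMap Γ(X, W)
        (Localization.AtPrime (hW.primeIdealOf ⟨y, hyW⟩).asIdeal))).map
      (IsLocalization.algEquiv (hW.primeIdealOf ⟨y, hyW⟩).asIdeal.primeCompl
        (Localization.AtPrime (hW.primeIdealOf ⟨y, hyW⟩).asIdeal) (X.presheaf.stalk y) :
          Localization.AtPrime (hW.primeIdealOf ⟨y, hyW⟩).asIdeal →+* X.presheaf.stalk y) := by
  letI := TopCat.Presheaf.algebra_section_stalk X.presheaf (⟨y, hyW⟩ : W)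
  haveI := hW.isLocalization_stalk ⟨y, hyW⟩
  rw [Ideal.map_map, stalkIdeal_eq_map_germ I ⟨W, hW⟩ hyW]
  congr 1
  refine RingHom.ext fun r => ?_
  rw [RingHom.comp_apply]
  exact ((IsLocalization.algEquiv (hW.primeIdealOf ⟨y, hyW⟩).asIdeal.primeCompl
    (Localization.AtPrime (hW.primeIdealOf ⟨y, hyW⟩).asIdeal) (X.presheaf.stalk y)).commutes r).symm

/-- If, on an affine open `W ∋ y`, the extension of `I(W)` to `R_𝔮` (`𝔮` the prime of `y`) is the extension of a principal
ideal `(a)`, then the stalk `I_y` is generated by the germ of `a`. [folklore] -/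
theorem stalkIdeal_eq_span_germ_of_map_eq (I : X.IdealSheafData) {y : X} (hyW : y ∈ W) (a : Γ(X, W))
    (h : (I.ideal ⟨W, hW⟩).map (algebraMap Γ(X, W) (Localization.AtPrime (hW.primeIdealOf ⟨y, hyW⟩).asIdeal)) =
      (Ideal.span {a}).map (algebraMap Γ(X, W) (Localization.AtPrime (hW.primeIdealOf ⟨y, hyW⟩).asIdeal))) :
    stalkIdeal I y = Ideal.span {(X.presheaf.germ W y hyW).hom a} := by
  letI := TopCat.Presheaf.algebra_section_stalk X.presheaf (⟨y, hyW⟩ : W)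
  haveI := hW.isLocalization_stalk ⟨y, hyW⟩
  have hc : (IsLocalization.algEquiv (hW.primeIdealOf ⟨y, hyW⟩).asIdeal.primeCompl
      (Localization.AtPrime (hW.primeIdealOf ⟨y, hyW⟩).asIdeal) (X.presheaf.stalk y) :
        Localization.AtPrime (hW.primeIdealOf ⟨y, hyW⟩).asIdeal →+* X.presheaf.stalk y)
      (algebraMap Γ(X, W) _ a) = (X.presheaf.germ W y hyW).hom a :=
    (IsLocalization.algEquiv (hW.primeIdealOf ⟨y, hyW⟩).asIdeal.primeCompl
      (Localization.AtPrime (hW.primeIdealOf ⟨y, hyW⟩).asIdeal) (X.presheaf.stalk y)).commutes a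
  rw [stalkIdeal_eq_map_map_algEquiv hW I hyW, h, Ideal.map_span, Set.image_singleton, Ideal.map_span,
    Set.image_singleton, hc]

/-- Conversely, if the stalk `I_y` is generated by one germ `w`, then the extension of `I(W)` to `R_𝔮` is generated by the
element of `R_𝔮` corresponding to `w`. [folklore] -/
theorem map_ideal_eq_span_of_stalkIdeal_eq (I : X.IdealSheafData) {y : X} (hyW : y ∈ W) (w : X.presheaf.stalk y)
    (h : stalkIdeal I y = Ideal.span {w}) :
    letI := TopCat.Presheaf.algebra_section_stalk X.presheaf (⟨y, hyW⟩ : W)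
    haveI := hW.isLocalization_stalk ⟨y, hyW⟩
    (I.ideal ⟨W, hW⟩).map (algebraMap Γ(X, W) (Localization.AtPrime (hW.primeIdealOf ⟨y, hyW⟩).asIdeal)) =
      Ideal.span {(IsLocalization.algEquiv (hW.primeIdealOf ⟨y, hyW⟩).asIdeal.primeCompl
        (Localization.AtPrime (hW.primeIdealOf ⟨y, hyW⟩).asIdeal) (X.presheaf.stalk y)).symm w} := by
  letI := TopCat.Presheaf.algebra_section_stalk X.presheaf (⟨y, hyW⟩ : W)
  haveI := hW.isLocalization_stalk ⟨y, hyW⟩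
  set e := IsLocalization.algEquiv (hW.primeIdealOf ⟨y, hyW⟩).asIdeal.primeCompl
    (Localization.AtPrime (hW.primeIdealOf ⟨y, hyW⟩).asIdeal) (X.presheaf.stalk y) with he
  have h1 := stalkIdeal_eq_map_map_algEquiv hW I hyW
  rw [h] at h1
  have hid : (e.symm : X.presheaf.stalk y →+* Localization.AtPrime (hW.primeIdealOf ⟨y, hyW⟩).asIdeal).comp
      (e : Localization.AtPrime (hW.primeIdealOf ⟨y, hyW⟩).asIdeal →+* X.presheaf.stalk y) = RingHom.id _ :=
    RingHom.ext fun z => e.symm_apply_apply z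
  have h2 := congrArg
    (Ideal.map (e.symm : X.presheaf.stalk y →+* Localization.AtPrime (hW.primeIdealOf ⟨y, hyW⟩).asIdeal)) h1
  rw [Ideal.map_map, hid, Ideal.map_id, Ideal.map_span, Set.image_singleton] at h2
  exact h2.symm

end Chart

/-! ## §3 The SNC-with locus is open: local form at a point -/

section Local

variable {X : Scheme.{u}} [IsNoetherian X]

/-- **`SNCWithAt 𝓕 ⊤` spreads from a point to an open neighbourhood** on a Noetherian quasi-excellent scheme (see the
module docstring for the proof). [cite: Matsumura1987, Thm. 14.2 and §32 p. 260] -/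
theorem exists_mem_forall_sncWithAt (hX : Scheme.IsQuasiExcellent X) (𝓕 : List X.IdealSheafData) {x : X}
    (h : SNCWithAt 𝓕 ⊤ x) : ∃ U : X.Opens, x ∈ U ∧ ∀ y ∈ U, SNCWithAt 𝓕 ⊤ y := by
  classical
  obtain ⟨W, hW, hxW, -⟩ := exists_isAffineOpen_mem_and_subset (X := X) (x := x) (U := ⊤) trivial
  -- the chart ring, the prime of `x`, the stalk as a localisation, `e : R_𝔭 ≅ 𝒪_{X,x}`
  set R := Γ(X, W) with hR
  haveI : IsNoetherianRing R := IsLocallyNoetherian.component_noetherian ⟨W, hW⟩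
  set 𝔭 : Ideal R := (hW.primeIdealOf ⟨x, hxW⟩).asIdeal with h𝔭
  letI algx := TopCat.Presheaf.algebra_section_stalk X.presheaf (⟨x, hxW⟩ : W)
  haveI locx : IsLocalization.AtPrime (X.presheaf.stalk x) 𝔭 := hW.isLocalization_stalk ⟨x, hxW⟩
  let e : Localization.AtPrime 𝔭 ≃ₐ[R] X.presheaf.stalk x :=
    IsLocalization.algEquiv 𝔭.primeCompl (Localization.AtPrime 𝔭) (X.presheaf.stalk x)
  -- the pointwise hypothesis at `x`
  obtain ⟨hregS, d, v, hd, hv, ⟨ι, hι, hιD⟩, -⟩ := h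
  haveI := hregS
  haveI hregL : IsRegularLocalRing (Localization.AtPrime 𝔭) := IsRegularLocalRing.of_ringEquiv e.symm.toRingEquiv
  have hvmem : ∀ i, v i ∈ maximalIdeal (X.presheaf.stalk x) := fun i => hv ▸ Ideal.subset_span ⟨i, rfl⟩
  have hdimS : ringKrullDim (X.presheaf.stalk x) = d := by
    have := IsRegularLocalRing.spanFinrank_maximalIdeal (R := X.presheaf.stalk x)
    rw [hd] at this
    exact this.symm
  -- the members of `𝓕` through `x`, enumerated by `σ : Fin r ≃ _`
  haveI : Finite {D : X.IdealSheafData // D ∈ 𝓕 ∧ x ∈ D.support} := Finite.of_injective ι hι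
  obtain ⟨r, ⟨σ'⟩⟩ := Finite.exists_equiv_fin {D : X.IdealSheafData // D ∈ 𝓕 ∧ x ∈ D.support}
  let σ := σ'.symm
  let τ : Fin r → Fin d := fun k => ι (σ k)
  have hτ : Function.Injective τ := hι.comp σ.injective
  -- the adapted parameters of the members through `x`, in the stalk and in `R_𝔭`
  let w : Fin r → X.presheaf.stalk x := fun k => v (τ k)
  have hw : ∀ k, w k ∈ maximalIdeal (X.presheaf.stalk x) := fun k => hvmem (τ k)
  have hwD : ∀ k, stalkIdeal (σ k).1 x = Ideal.span {w k} := fun k => hιD (σ k)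
  have hindw : ∀ c : Fin r → X.presheaf.stalk x, ∑ k, c k * w k ∈ (maximalIdeal (X.presheaf.stalk x)) ^ 2 →
      ∀ k, c k ∈ maximalIdeal (X.presheaf.stalk x) :=
    (linearIndependent_toCotangent_iff_forall_mem w hw).mp
      ((linearIndependent_toCotangent_of_span_eq_maximalIdeal hdimS v hv).comp τ hτ)
  let xL : Fin r → Localization.AtPrime 𝔭 := fun k => e.symm (w k)
  have hindxL : ∀ c : Fin r → Localization.AtPrime 𝔭, ∑ k, c k * xL k ∈ (maximalIdeal (Localization.AtPrime 𝔭)) ^ 2 →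
      ∀ k, c k ∈ maximalIdeal (Localization.AtPrime 𝔭) :=
    forall_mem_maximalIdeal_of_ringEquiv e.symm.toRingEquiv w hindw
  have hxLmem : ∀ k, xL k ∈ maximalIdeal (Localization.AtPrime 𝔭) := fun k =>
    (mem_maximalIdeal_iff_of_ringEquiv e.symm.toRingEquiv (w k)).mp (hw k)
  -- clear denominators: `a k / s k = xL k`
  choose as has using fun k => IsLocalization.surj 𝔭.primeCompl (xL k)
  let a : Fin r → R := fun k => (as k).1
  have hsunit : ∀ k, IsUnit (algebraMap R (Localization.AtPrime 𝔭) ((as k).2 : R)) := fun k =>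
    IsLocalization.map_units (Localization.AtPrime 𝔭) (as k).2
  have hax : ∀ k, algebraMap R (Localization.AtPrime 𝔭) (a k) =
      xL k * algebraMap R (Localization.AtPrime 𝔭) ((as k).2 : R) := fun k => (has k).symm
  have hx' : ∀ k, algebraMap R (Localization.AtPrime 𝔭) (a k) ∈ maximalIdeal (Localization.AtPrime 𝔭) :=
    fun k => by rw [hax k]; exact Ideal.mul_mem_right _ _ (hxLmem k)
  have hind' : ∀ c : Fin r → Localization.AtPrime 𝔭,
      ∑ k, c k * algebraMap R (Localization.AtPrime 𝔭) (a k) ∈ (maximalIdeal (Localization.AtPrime 𝔭)) ^ 2 →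
      ∀ k, c k ∈ maximalIdeal (Localization.AtPrime 𝔭) := by
    intro c hc k
    have heq : ∑ k, (c k * algebraMap R (Localization.AtPrime 𝔭) ((as k).2 : R)) * xL k =
        ∑ k, c k * algebraMap R (Localization.AtPrime 𝔭) (a k) :=
      Finset.sum_congr rfl fun k _ => by rw [hax k]; ring
    have hc' : ∑ k, (c k * algebraMap R (Localization.AtPrime 𝔭) ((as k).2 : R)) * xL k ∈
        (maximalIdeal (Localization.AtPrime 𝔭)) ^ 2 := by
      rw [heq]; exact hc
    exact (Ideal.mul_unit_mem_iff_mem _ (hsunit k)).mp (hindxL _ hc' k)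
  have hli' : LinearIndependent (ResidueField (Localization.AtPrime 𝔭)) fun k =>
      (maximalIdeal (Localization.AtPrime 𝔭)).toCotangent ⟨algebraMap R (Localization.AtPrime 𝔭) (a k), hx' k⟩ :=
    (linearIndependent_toCotangent_iff_forall_mem _ hx').mpr hind'
  -- the ideal of each member through `x` is `(a k)` at `𝔭`
  have hIeq : ∀ k, ((σ k).1.ideal ⟨W, hW⟩).map (algebraMap R (Localization.AtPrime 𝔭)) =
      (Ideal.span {a k}).map (algebraMap R (Localization.AtPrime 𝔭)) := by
    intro k
    rw [map_ideal_eq_span_of_stalkIdeal_eq hW (σ k).1 hxW (w k) (hwD k), Ideal.map_span, Set.image_singleton, hax k,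
      Ideal.span_singleton_mul_right_unit (hsunit k)]
  -- J-2: the regular loci of the quotients of `R` are open
  have hopen : ∀ T : Finset (Fin r), IsOpen (regularLocus (R ⧸ Ideal.span (a '' (T : Set (Fin r))))) :=
    fun T => (hX ⟨W, hW⟩).2.2 _ inferInstance
  -- the ring theorem and the spreading steps
  obtain ⟨f₀, hf₀, hP⟩ := exists_notMem_forall_independent 𝔭 a hx' hli' hopen
  obtain ⟨f₁, hf₁, hIq⟩ := exists_notMem_forall_map_eq_family 𝔭 (fun k => (σ k).1.ideal ⟨W, hW⟩)
    (fun k => Ideal.span {a k}) hIeq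
  -- members NOT through `x` stay away
  have hfar : ∀ D : {D : X.IdealSheafData // D ∈ 𝓕}, ∃ b ∉ 𝔭, x ∉ D.1.support → b ∈ D.1.ideal ⟨W, hW⟩ := by
    intro D
    by_cases hxD : x ∈ D.1.support
    · exact ⟨1, fun h1 => (hW.primeIdealOf ⟨x, hxW⟩).2.ne_top ((Ideal.eq_top_iff_one _).mpr h1),
        fun h' => (h' hxD).elim⟩
    · have hnle : ¬ D.1.ideal ⟨W, hW⟩ ≤ 𝔭 := fun hle => hxD ((mem_support_iff_ideal_le hW D.1 hxW).mpr hle)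
      obtain ⟨b, hb, hb𝔭⟩ := Set.not_subset.mp hnle
      exact ⟨b, hb𝔭, fun _ => hb⟩
  choose b hb𝔭 hbD using hfar
  haveI : Finite {D : X.IdealSheafData // D ∈ 𝓕} := 𝓕.finite_toSet.to_subtype
  haveI : Fintype {D : X.IdealSheafData // D ∈ 𝓕} := Fintype.ofFinite _
  have hf𝔭 : f₀ * f₁ * ∏ D, b D ∉ 𝔭 := mul_mem (s := 𝔭.primeCompl) (mul_mem (s := 𝔭.primeCompl) hf₀ hf₁)
    (prod_mem (S := 𝔭.primeCompl) fun D _ => hb𝔭 D)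
  refine ⟨X.basicOpen (f₀ * f₁ * ∏ D, b D), (mem_basicOpen_iff_notMem_primeIdealOf hW hxW _).mpr hf𝔭,
    fun y hyU => ?_⟩
  /- at a point `y ∈ D(f)`: the prime `𝔮`, the stalk as a localisation, `e' : R_𝔮 ≅ 𝒪_{X,y}` -/
  have hyW : y ∈ W := X.basicOpen_le _ hyU
  set 𝔮 : Ideal R := (hW.primeIdealOf ⟨y, hyW⟩).asIdeal with h𝔮
  have hf𝔮 : f₀ * f₁ * ∏ D, b D ∉ 𝔮 := (mem_basicOpen_iff_notMem_primeIdealOf hW hyW _).mp hyU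
  have hf₀𝔮 : f₀ ∉ 𝔮 := notMem_of_dvd_of_notMem ((dvd_mul_right _ _).trans (dvd_mul_right _ _)) hf𝔮
  have hf₁𝔮 : f₁ ∉ 𝔮 := notMem_of_dvd_of_notMem ((dvd_mul_left _ _).trans (dvd_mul_right _ _)) hf𝔮
  have hb𝔮 : ∀ D, b D ∉ 𝔮 := fun D =>
    notMem_of_dvd_of_notMem ((Finset.dvd_prod_of_mem b (Finset.mem_univ D)).trans (dvd_mul_left _ _)) hf𝔮
  letI algy := TopCat.Presheaf.algebra_section_stalk X.presheaf (⟨y, hyW⟩ : W)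
  haveI locy : IsLocalization.AtPrime (X.presheaf.stalk y) 𝔮 := hW.isLocalization_stalk ⟨y, hyW⟩
  let e' : Localization.AtPrime 𝔮 ≃ₐ[R] X.presheaf.stalk y :=
    IsLocalization.algEquiv 𝔮.primeCompl (Localization.AtPrime 𝔮) (X.presheaf.stalk y)
  obtain ⟨hregB, hindB⟩ := hP 𝔮 hf₀𝔮
  haveI := hregB
  haveI hregS' : IsRegularLocalRing (X.presheaf.stalk y) := IsRegularLocalRing.of_ringEquiv e'.toRingEquiv
  -- the germs of the `a k` at `y` generate the stalks of the members through `x`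
  let g : Fin r → X.presheaf.stalk y := fun k => (X.presheaf.germ W y hyW).hom (a k)
  have hge : ∀ k, g k = e' (algebraMap R (Localization.AtPrime 𝔮) (a k)) := fun k => (e'.commutes (a k)).symm
  have hgD : ∀ k, stalkIdeal (σ k).1 y = Ideal.span {g k} := fun k =>
    stalkIdeal_eq_span_germ_of_map_eq hW (σ k).1 hyW (a k) (hIq 𝔮 hf₁𝔮 k)
  have hgsupp : ∀ k, y ∈ (σ k).1.support ↔ a k ∈ 𝔮 := by
    intro k
    rw [mem_support_iff_stalkIdeal_le, hgD k, Ideal.span_singleton_le_iff_mem]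
    exact IsLocalization.AtPrime.to_map_mem_maximal_iff (X.presheaf.stalk y) 𝔮 (a k)
  -- every member through `y` passes through `x`
  have hthrough : ∀ D ∈ 𝓕, y ∈ D.support → x ∈ D.support := by
    intro D hD hyD
    by_contra hxD
    exact hb𝔮 ⟨D, hD⟩ ((mem_support_iff_ideal_le hW D hyW).mp hyD (hbD ⟨D, hD⟩ hxD))
  -- the sub-family vanishing at `y`, enumerated by `ε : Fin t → Fin r`
  set T₀ : Finset (Fin r) := Finset.univ.filter fun k => a k ∈ 𝔮 with hT₀
  have hmemT₀ : ∀ k, k ∈ T₀ ↔ a k ∈ 𝔮 := fun k => by simp [hT₀]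
  let εT : Fin T₀.card ≃ T₀ := T₀.equivFin.symm
  let ε : Fin T₀.card → Fin r := fun j => (εT j : Fin r)
  have hε : Function.Injective ε := fun j j' hjj' => εT.injective (Subtype.ext hjj')
  have hε𝔮 : ∀ j, a (ε j) ∈ 𝔮 := fun j => (hmemT₀ _).mp (εT j).2
  -- independent differentials of the `g (ε j)` in `𝒪_{X,y}`, then a regular system of parameters extending them
  have hindS' : ∀ c : Fin T₀.card → X.presheaf.stalk y,
      ∑ j, c j * g (ε j) ∈ (maximalIdeal (X.presheaf.stalk y)) ^ 2 → ∀ j, c j ∈ maximalIdeal (X.presheaf.stalk y) := by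
    have key := forall_mem_maximalIdeal_of_ringEquiv e'.toRingEquiv
      (fun j => algebraMap R (Localization.AtPrime 𝔮) (a (ε j))) (hindB _ ε hε hε𝔮)
    intro c hc
    have heq : ∑ j, c j * e'.toRingEquiv (algebraMap R (Localization.AtPrime 𝔮) (a (ε j))) = ∑ j, c j * g (ε j) :=
      Finset.sum_congr rfl fun j _ => by rw [hge]; rfl
    rw [← heq] at hc
    exact key c hc
  have hgm : ∀ j, g (ε j) ∈ maximalIdeal (X.presheaf.stalk y) := fun j =>
    (IsLocalization.AtPrime.to_map_mem_maximal_iff (X.presheaf.stalk y) 𝔮 (a (ε j))).mpr (hε𝔮 j)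
  obtain ⟨e₁, y₁, hdim, hspan⟩ := exists_extend_to_rsop (fun j => g (ε j)) hgm hindS'
  -- assemble `SNCWithAt 𝓕 ⊤ y`
  refine ⟨hregS', T₀.card + e₁, Fin.append (fun j => g (ε j)) y₁, ?_, ?_, ?_, fun hy => ?_⟩
  · have := IsRegularLocalRing.spanFinrank_maximalIdeal (R := X.presheaf.stalk y)
    rw [hdim] at this
    exact_mod_cast this
  · rw [span_range_append, hspan]
  · -- labels: a member `D` through `y` passes through `x`, is `σ k` with `a k ∈ 𝔮`, i.e. `k = ε j`
    have key : ∀ D : {D : X.IdealSheafData // D ∈ 𝓕 ∧ y ∈ D.support}, ∃ j : Fin T₀.card, (σ (ε j)).1 = D.1 := by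
      rintro ⟨D, hD𝓕, hyD⟩
      obtain ⟨k, hk⟩ : ∃ k : Fin r, (σ k).1 = D :=
        ⟨σ.symm ⟨D, hD𝓕, hthrough D hD𝓕 hyD⟩, by rw [Equiv.apply_symm_apply]⟩
      have hkT : k ∈ T₀ := (hmemT₀ k).mpr ((hgsupp k).mp (hk.symm ▸ hyD))
      refine ⟨εT.symm ⟨k, hkT⟩, ?_⟩
      have : ε (εT.symm ⟨k, hkT⟩) = k := by
        change ((εT (εT.symm ⟨k, hkT⟩) : T₀) : Fin r) = k
        rw [Equiv.apply_symm_apply]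
      rw [this, hk]
    choose jOf hjOf using key
    refine ⟨fun D => Fin.castAdd e₁ (jOf D), ?_, ?_⟩
    · intro D₁ D₂ h12
      have hj : jOf D₁ = jOf D₂ := Fin.castAdd_injective _ _ h12
      apply Subtype.ext
      rw [← hjOf D₁, ← hjOf D₂, hj]
    · intro D
      rw [Fin.append_left, ← hgD (ε (jOf D)), hjOf D]
  · exact absurd hy (by rw [Scheme.IdealSheafData.support_top]; exact id)

end Local

/-! ## §4 The global forms -/

section Global

variable {X : Scheme.{u}} [IsNoetherian X]

/-- **The SNC-with locus is open — union form**: if `SNCWithAt 𝓕 ⊤` holds at every point of a set `Z` then on an open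
set containing `Z` (the union of the pointwise neighbourhoods of §3; no compactness or closedness needed). [folklore] -/
theorem exists_isOpen_forall_sncWithAt' (hX : Scheme.IsQuasiExcellent X) (𝓕 : List X.IdealSheafData) {Z : Set X}
    (h : ∀ x ∈ Z, SNCWithAt 𝓕 ⊤ x) :
    ∃ U : X.Opens, Z ⊆ (U : Set X) ∧ ∀ y ∈ (U : Set X), SNCWithAt 𝓕 ⊤ y := by
  choose U hxU hU using fun z : Z => exists_mem_forall_sncWithAt hX 𝓕 (h z.1 z.2)
  refine ⟨⨆ z, U z, fun z hz => ?_, fun y hy => ?_⟩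
  · exact Opens.mem_iSup.mpr ⟨⟨z, hz⟩, hxU ⟨z, hz⟩⟩
  · obtain ⟨z, hz⟩ := Opens.mem_iSup.mp hy
    exact hU z y hz

/-- **The SNC-with locus is open** — the form of record named by res-L1-w52-plan-1 (RULING G11-17 (4) (c); NAMING
2026-08-27T16:26:25Z): on a Noetherian quasi-excellent scheme, if `SNCWithAt 𝓕 ⊤` holds at every point of a closed set
`Z`, it holds at every point of an open `U ⊇ Z`. (The closedness hypothesis is part of the named signature and is not
used: `exists_isOpen_forall_sncWithAt'`.) [folklore] -/
theorem exists_isOpen_forall_sncWithAt (hX : Scheme.IsQuasiExcellent X) (𝓕 : List X.IdealSheafData) {Z : Set X}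
    (_hZ : IsClosed Z) (h : ∀ x ∈ Z, SNCWithAt 𝓕 ⊤ x) :
    ∃ U : X.Opens, Z ⊆ (U : Set X) ∧ ∀ y ∈ (U : Set X), SNCWithAt 𝓕 ⊤ y :=
  exists_isOpen_forall_sncWithAt' hX 𝓕 h

end Global

end DepthSNC

end Summit.ResolutionOfSingularities.ResolutionOfSingularities.Theorems

end
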